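import Summits.ResolutionOfSingularities.ResolutionOfSingularities.Theorems.EquisingularLiftEquisingularLiftNatNoseThenPointsHoriz
import HarnessLib

/-!
# [OURS · L1 W4.5(b) · EL♮] (5) T-NOSE-THEN-POINTS IN THE HORIZONTAL CURRENCY, INTRINSIC DOWNSTAIRS FORM «blow `H` up along
# `Λ · 𝒪_H`, then resolve by point blow-ups (or: that blow-up is already regular) ⇒ a HorizChainE1 stage with regular reduced
# strict transform» (res-L1-w45b-lead-2 TARGET-CINOSE 2026-08-27T08:49:13Z; res-D-pv-027's cut (L2) «T-ORD-CI», 08:47:30Z), any `n`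

Crux `EquisingularLiftNat` = stmt-ResolutionOfSingularities-20038 (route EquisingularLift), child EL♮(3) = stmt-…-20148, line
`sections`; helper file `--supports … --as helper` by res-type-051 (g14). HONEST FRAMING: OURS (cell res-hironaka, slot W4.5(b));
NOT a statement of any manuscript; a CONDITIONAL rung (hypothesis (a) = an `O`-SMOOTH lift of the nose — a LIFT-type hypothesis,
supplied by R1 for linear centres and by T-LIFT-CI for smooth complete intersections; hypothesis (b′) = classical downstairs
resolution data). AI-written, weaker than expert review. No `sorry`; standard axioms.

The sibling …NatNoseThenPointsHoriz.lean states (b) on the EMBEDDED strict transform `closure υ⁻¹(ι(H) ∖ Σ) ⊆ Bl_Σ ℙⁿ_k`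
(TARGET-CINOSE's registered text). Specimen authors compute with the blown-up surface itself (res-D-pv-027's (L2): «`Σ` a smooth
complete-intersection curve on `H ⊂ ℙ³`, SOME blow-up of `H` along `𝓘_Σ · 𝒪_H` REGULAR»), so this file moves (b) to `H`, exactly as
…NatNoseThenPointsIntrinsic.lean (p514247) did for the item's currency:

* `horiz_of_noseThenPoints_intrinsic` — HYP (a) as in the sibling; HYP (b′): SOME blow-up `ρ : Z → H` along `Λ · 𝒪_H = Λ.comap ι`
  is point-resolvable INTRINSICALLY (PtChain ∃-form for `(Z, univ)`) ⇒ for `Y = (ι ≫ Proj φ)(H)` some `(P′, σ, S′)` in the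
  HorizChainE1 closure of `(ℙⁿ_O, 𝟙, Y)` (WITH `Flat`) with irreducible special fibre, good reduction over `𝔪_O`, regular
  `V(closure S′)_red`. PROOF: the p514247 identification `V(closure univ)_red ≅ Z ≅` (nose-stage strict transform) (Stacks 080E via
  `exists_isBlowup_reducedStrictTransform`, `IsBlowup.unique`), then `pointResolution_from_horizStage` (p509452) — stopped there;
* `horizOver_of_noseThenPoints_intrinsic_closed` / `horizAt_of_noseThenPoints_intrinsic_closed` — downstairs centre a CLOSED SET
  `Σ ⊆ ι(H)`, `ι(H) ⊄ Σ`, nose with `C · 𝒪_{ℙⁿ_k} = vanishingIdeal Σ` along every graded `φ` over `π` (resp. a LIFT SUPPLY over all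
  complete `(O, π)`, `O := 𝕎(k)` by `stub_wittRing`), (b′) on a blow-up of `H` along `(vanishingIdeal Σ) · 𝒪_H` ⇒ TARGET-CINOSE's
  conclusion (after «`Function.Surjective π ∧`», resp. verbatim);
* `horizAt_of_nose_of_isRegular_blowup_closed` — (L2)'s shape: LIFT SUPPLY for `Σ` + SOME blow-up of `H` along
  `(vanishingIdeal Σ) · 𝒪_H` is REGULAR ⇒ TARGET-CINOSE's conclusion.

References: …NatNoseThenPointsHoriz.lean (sibling), …NatNoseThenPointsIntrinsic.lean (p514247), …NatNosePackage.lean (p512238),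
…NatPointResolutionRel.lean (p509452), …ReducedStrictTransformBlowup.lean (p167331); Liu 2002 §8.1; Stacks 080E.
-/

set_option linter.dupNamespace false -- mandated namespace `Summit.<Summit>.<Problem>` of this single-conjunct summit
set_option linter.overlappingInstances false -- signatures carry `[IsDomain O] [IsDiscreteValuationRing O]`

noncomputable section

open CategoryTheory CategoryTheory.Limits AlgebraicGeometry TopologicalSpace Topology
open MvPolynomial
open Literature.AlgebraicGeometry.Resolution
open AlgebraicGeometry.Scheme.IdealSheafData
open Summit.ResolutionOfSingularities.ResolutionOfSingularities.Theses.EquisingularLift.Split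
open Summit.ResolutionOfSingularities.ResolutionOfSingularities.Cruxes.EquisingularLift.StrataSplit

attribute [local instance] MvPolynomial.gradedAlgebra

namespace Summit.ResolutionOfSingularities.ResolutionOfSingularities.Cruxes.EquisingularLiftNat.Sections

/-! ## The nose out of `ℙⁿ_O`, then point steps on a blow-up of `H` — stopped at the horizontal stage -/

/-- **(5) T-NOSE-THEN-POINTS, horizontal form, downstairs hypothesis on `H` itself, four conjuncts** (module docstring for the
reading): `O` a complete DVR with algebraically closed residue field, `π : O → k` surjective, `ι : H → ℙⁿ_k` a closed immersion of
an integral scheme, `φ` graded over `π`, `Y = (ι ≫ Proj φ)(H)`; (a) `C ⊂ ℙⁿ_O` with `V(C) → Spec O` SMOOTH, `ι(H) ⊄ V(Λ)`,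
`V(Λ) ⊆ ι(H)` (`Λ = C · 𝒪_{ℙⁿ_k}`); (b′) some blow-up `Z → H` along `Λ · 𝒪_H` is resolved by finitely many point blow-ups at
non-regular closed points (PtChain ∃-form for `(Z, univ)`). THEN some `(P′, σ, S′)` in the HorizChainE1 closure of `(ℙⁿ_O, 𝟙, Y)`
(WITH the `Flat` clause) has irreducible special fibre, good reduction at every point over `𝔪_O`, and regular `V(closure S′)_red`.
[folklore; Liu 2002 §8.1/§9.2; Stacks 080E] -/
theorem horiz_of_noseThenPoints_intrinsic (O : Type) [CommRing O] [IsDomain O] [IsDiscreteValuationRing O]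
    [IsAdicComplete (IsLocalRing.maximalIdeal O) O] [IsAlgClosed (IsLocalRing.ResidueField O)]
    (k : Type) [Field k] (π : O →+* k) (hπ : Function.Surjective π) (n : ℕ) (H : Scheme.{0})
    (ι : H ⟶ Proj (homogeneousSubmodule (Fin (n + 1)) k)) [IsClosedImmersion ι] [IsIntegral H]
    (φ : homogeneousSubmodule (Fin (n + 1)) O →+*ᵍ homogeneousSubmodule (Fin (n + 1)) k)
    (hφ' : HomogeneousIdeal.irrelevant (homogeneousSubmodule (Fin (n + 1)) k) ≤
      (HomogeneousIdeal.irrelevant (homogeneousSubmodule (Fin (n + 1)) O)).map φ)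
    (hφ : ∀ s, φ s = MvPolynomial.map π s)
    -- (a) THE NOSE
    (C : (Proj (homogeneousSubmodule (Fin (n + 1)) O)).IdealSheafData)
    (hCsm : Smooth (C.subschemeι ≫ Proj.toSpecZero (homogeneousSubmodule (Fin (n + 1)) O) ≫
      Spec.map (CommRingCat.ofHom (algebraMap O (homogeneousSubmodule (Fin (n + 1)) O 0)))))
    (hgen : ¬ (Set.range ι ⊆ ((C.comap (Proj.map φ hφ')).support : Set (Proj (homogeneousSubmodule (Fin (n + 1)) k)))))
    (hsupp : ((C.comap (Proj.map φ hφ')).support : Set (Proj (homogeneousSubmodule (Fin (n + 1)) k))) ⊆ Set.range ι)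
    -- (b′) THEN POINTS, intrinsically on a blow-up of `H` along `Λ · 𝒪_H`
    (hdown : ∃ (Z : Scheme.{0}) (ρ : Z ⟶ H), IsBlowup ρ ((C.comap (Proj.map φ hφ')).comap ι) ∧
      ∃ (F' : Scheme.{0}) (ρ' : F' ⟶ Z) (T' : Set F'),
        (∀ Q : (∀ F₁ : Scheme.{0}, (F₁ ⟶ Z) → Set F₁ → Prop), Q Z (𝟙 Z) Set.univ →
          (∀ (F₁ F₃ : Scheme.{0}) (ρ₁ : F₁ ⟶ Z) (T₁ : Set F₁)
            (x : ↥(vanishingIdeal (⟨closure T₁, isClosed_closure⟩ : Closeds F₁)).subscheme) (υ₁ : F₃ ⟶ F₁)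
            (hx : IsClosed ({((vanishingIdeal (⟨closure T₁, isClosed_closure⟩ : Closeds F₁)).subschemeι x : F₁)} : Set F₁)),
            Q F₁ ρ₁ T₁ →
            ¬ IsRegularLocalRing ((vanishingIdeal (⟨closure T₁, isClosed_closure⟩ : Closeds F₁)).subscheme.presheaf.stalk x) →
            IsBlowup υ₁ (vanishingIdeal
              (⟨{((vanishingIdeal (⟨closure T₁, isClosed_closure⟩ : Closeds F₁)).subschemeι x : F₁)}, hx⟩ : Closeds F₁)) →
            Q F₃ (υ₁ ≫ ρ₁) (closure (υ₁ ⁻¹' (T₁ \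
              {((vanishingIdeal (⟨closure T₁, isClosed_closure⟩ : Closeds F₁)).subschemeι x : F₁)})))) →
          Q F' ρ' T') ∧
        Scheme.IsRegular (vanishingIdeal (⟨closure T', isClosed_closure⟩ : Closeds F')).subscheme) :
    ∀ Y : Set (Proj (homogeneousSubmodule (Fin (n + 1)) O)), Y = Set.range (ι ≫ Proj.map φ hφ') →
    ∃ (P' : Scheme.{0}) (σ : P' ⟶ Proj (homogeneousSubmodule (Fin (n + 1)) O)) (S' : Set P'),
      (∀ Q : (∀ X' : Scheme.{0}, (X' ⟶ Proj (homogeneousSubmodule (Fin (n + 1)) O)) → Set X' → Prop),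
        Q (Proj (homogeneousSubmodule (Fin (n + 1)) O)) (𝟙 _) Y →
        (∀ (X' X'' : Scheme.{0}) (σ' : X' ⟶ Proj (homogeneousSubmodule (Fin (n + 1)) O)) (Y' : Set X')
          (C : X'.IdealSheafData) (τ : X'' ⟶ X'), Q X' σ' Y' → IsBlowup τ C → Scheme.IsRegular C.subscheme →
          Flat (C.subschemeι ≫ σ' ≫ (Proj.toSpecZero (homogeneousSubmodule (Fin (n + 1)) O) ≫
            Spec.map (CommRingCat.ofHom (algebraMap O (homogeneousSubmodule (Fin (n + 1)) O 0))))) →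
          σ' '' (C.support : Set X') ⊆ {x | ¬ IsGenericPoint x Y} →
          (C.support : Set X') ∩ (σ' ≫ (Proj.toSpecZero (homogeneousSubmodule (Fin (n + 1)) O) ≫
            Spec.map (CommRingCat.ofHom (algebraMap O (homogeneousSubmodule (Fin (n + 1)) O 0))))) ⁻¹'
            {IsLocalRing.closedPoint O} ⊆ Y' →
          Q X'' (τ ≫ σ') (closure (τ ⁻¹' (Y' \ (C.support : Set X'))))) → Q P' σ S') ∧
      IsIrreducible ((σ ≫ (Proj.toSpecZero (homogeneousSubmodule (Fin (n + 1)) O) ≫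
        Spec.map (CommRingCat.ofHom (algebraMap O (homogeneousSubmodule (Fin (n + 1)) O 0))))) ⁻¹'
        {IsLocalRing.closedPoint O}) ∧
      (∀ w : P', (σ ≫ (Proj.toSpecZero (homogeneousSubmodule (Fin (n + 1)) O) ≫
          Spec.map (CommRingCat.ofHom (algebraMap O (homogeneousSubmodule (Fin (n + 1)) O 0))))) w =
          IsLocalRing.closedPoint O →
        GoodAt (σ ≫ (Proj.toSpecZero (homogeneousSubmodule (Fin (n + 1)) O) ≫
          Spec.map (CommRingCat.ofHom (algebraMap O (homogeneousSubmodule (Fin (n + 1)) O 0))))) w) ∧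
      Scheme.IsRegular (vanishingIdeal (⟨closure S', isClosed_closure⟩ : Closeds P')).subscheme := by
  -- adapted from `elNatBody_of_noseThenPoints_intrinsic` (…NatNoseThenPointsIntrinsic.lean, p514247), stopped at the horizontal stage
  classical
  set q : (Proj (homogeneousSubmodule (Fin (n + 1)) O)) ⟶ Spec (.of O) := Proj.toSpecZero (homogeneousSubmodule (Fin (n + 1)) O) ≫
    Spec.map (CommRingCat.ofHom (algebraMap O (homogeneousSubmodule (Fin (n + 1)) O 0))) with hqdef
  set g : Proj (homogeneousSubmodule (Fin (n + 1)) k) ⟶ (Proj (homogeneousSubmodule (Fin (n + 1)) O)) := Proj.map φ hφ' with hgdef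
  set Λ : (Proj (homogeneousSubmodule (Fin (n + 1)) k)).IdealSheafData := C.comap g with hΛdef
  intro Y hY
  obtain ⟨Z, ρ, hρ, hres⟩ := hdown
  -- the two blow-ups: the nose upstairs, `Bl_Λ ℙⁿ_k` downstairs
  obtain ⟨P₁, τ, hτ⟩ := exists_isBlowup (Proj (homogeneousSubmodule (Fin (n + 1)) O)) C
  obtain ⟨F₂, υ, hυ⟩ := exists_isBlowup (Proj (homogeneousSubmodule (Fin (n + 1)) k)) Λ
  obtain ⟨hYcl, hYirr, hYs, hH₁, hirr₁, hgood₁, hF₂, hirrD, ⟨e₂⟩, -⟩ :=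
    nosePackage₀ O k π hπ n H ι φ hφ' hφ C hCsm hgen hsupp P₁ τ hτ F₂ υ hυ Y hY
  haveI := hF₂
  obtain ⟨hsm, hpr⟩ := stub_projectiveAmbientSmoothProper O n
  -- `ℙⁿ_k` and `H` are locally Noetherian
  haveI : IsLocallyNoetherian (Proj (homogeneousSubmodule (Fin (n + 1)) k)) := by
    haveI := (stub_projectiveAmbientSmoothProper k n).2
    exact LocallyOfFiniteType.isLocallyNoetherian
      (Proj.toSpecZero (homogeneousSubmodule (Fin (n + 1)) k) ≫
        Spec.map (CommRingCat.ofHom (algebraMap k ((homogeneousSubmodule (Fin (n + 1)) k) 0))))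
  haveI : IsLocallyNoetherian H := LocallyOfFiniteType.isLocallyNoetherian ι
  haveI : IsProper υ := hυ.isProper
  -- `H ≅ V(ι(H))_red`, compatibly with the embeddings
  have hιirr : IsIrreducible (Set.range ι) := by
    have h := (IrreducibleSpace.isIrreducible_univ H).image ι ι.continuous.continuousOn
    rwa [Set.image_univ] at h
  let TD : Closeds (Proj (homogeneousSubmodule (Fin (n + 1)) k)) := ⟨Set.range ι, ι.isClosedEmbedding.isClosed_range⟩
  have hDker : vanishingIdeal TD = ι.ker := by
    rw [← Scheme.IdealSheafData.map_bot, ← Scheme.nilradical_eq_bot, ← Scheme.IdealSheafData.vanishingIdeal_top,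
      Scheme.IdealSheafData.map_vanishingIdeal]
    congr 1
    ext1
    change Set.range ι = closure (ι '' Set.univ)
    rw [Set.image_univ, ι.isClosedEmbedding.isClosed_range.closure_eq]
  have hkerD : (vanishingIdeal TD).subschemeι.ker = ι.ker := by
    rw [Scheme.IdealSheafData.ker_subschemeι, hDker]
  let eD : H ⟶ (vanishingIdeal TD).subscheme := IsClosedImmersion.lift _ ι hkerD.le
  have heD : eD ≫ (vanishingIdeal TD).subschemeι = ι := IsClosedImmersion.lift_fac _ ι hkerD.le
  haveI : IsIso eD := IsClosedImmersion.isIso_lift _ ι hkerD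
  -- the embedded reduced strict transform is a blow-up of `V(ι(H))_red` along the trace of `Λ` (Stacks 080E), hence `≅ Z`
  obtain ⟨ρD, -, -, hρD⟩ := exists_isBlowup_reducedStrictTransform (Proj (homogeneousSubmodule (Fin (n + 1)) k)) F₂ υ Λ hυ
    (Set.range ι) ι.isClosedEmbedding.isClosed_range hιirr hgen
  have hb := hρD.comp_iso (asIso eD).symm
  have hcomap : (Λ.comap (vanishingIdeal TD).subschemeι).comap (asIso eD).symm.inv = Λ.comap ι := by
    rw [← Scheme.IdealSheafData.comap_comp]
    change Λ.comap (eD ≫ (vanishingIdeal TD).subschemeι) = Λ.comap ι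
    rw [heD]
  rw [hcomap] at hb
  obtain ⟨eZ, -, -⟩ := hρ.unique hb
  -- `Z` is integral and locally Noetherian; `V(closure univ)_red ≅ Z`
  have hΛι : Λ.comap ι ≠ ⊥ := by
    intro h
    apply hgen
    intro y hy
    obtain ⟨x, rfl⟩ := hy
    have hx : x ∈ ((Λ.comap ι).support : Set H) := by rw [h, Scheme.IdealSheafData.support_bot]; trivial
    rw [support_comap] at hx
    exact hx
  haveI hZint : IsIntegral Z := hρ.isIntegral hΛι
  haveI : IsProper ρ := hρ.isProper
  haveI hZnoeth : IsLocallyNoetherian Z := LocallyOfFiniteType.isLocallyNoetherian ρ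
  let TZ : Closeds Z := ⟨closure (Set.univ : Set Z), isClosed_closure⟩
  obtain ⟨eU, heU⟩ := isIso_lift_vanishingIdeal_closure_univ Z
  -- match the embedded strict-transform set with the one of `nosePackage₀`
  have hcl : (⟨closure (υ ⁻¹' (Set.range ι \ (Λ.support : Set (Proj (homogeneousSubmodule (Fin (n + 1)) k))))), isClosed_closure⟩ :
      Closeds F₂) = ⟨closure (closure (υ ⁻¹' (Set.range ι \ (Λ.support : Set (Proj (homogeneousSubmodule (Fin (n + 1)) k)))))),
      isClosed_closure⟩ := Closeds.ext (by
    change closure _ = closure (closure _)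
    rw [closure_closure])
  rw [hcl] at eZ
  let e : (vanishingIdeal TZ).subscheme ≅ (vanishingIdeal (⟨closure (closure (τ ⁻¹' (Y \
      (C.support : Set (Proj (homogeneousSubmodule (Fin (n + 1)) O)))))), isClosed_closure⟩ : Closeds P₁)).subscheme :=
    (asIso eU).symm ≪≫ eZ ≪≫ e₂
  have hTZirr : IsIrreducible (Set.univ : Set Z) := IrreducibleSpace.isIrreducible_univ Z
  let Yc : Closeds (Proj (homogeneousSubmodule (Fin (n + 1)) O)) := ⟨Y, hYcl⟩
  -- then points: T-ISO-0-REL from the nose stage with the INTRINSIC downstairs datum `(Z, univ)`, stopped at the horizontal stage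
  obtain ⟨X₂, σ₂, S₂, hH₂, hirr₂, hgood₂, hreg₂⟩ := pointResolution_from_horizStage O (Proj (homogeneousSubmodule (Fin (n + 1)) O))
    q Yc hsm hpr hYs hYirr P₁ τ (closure (τ ⁻¹' (Y \ (C.support : Set (Proj (homogeneousSubmodule (Fin (n + 1)) O))))))
    hH₁ hirr₁ (fun w _ => hgood₁ w) Z (Set.univ : Set Z) isClosed_univ hTZirr e hres
  exact ⟨X₂, σ₂, S₂, hH₂, hirr₂, hgood₂, hreg₂⟩

/-! ## Packaging for a CLOSED SET `Σ ⊆ ℙⁿ_k` as the downstairs centre (`Λ := vanishingIdeal Σ`) -/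

/-- **Horizontal (5), intrinsic downstairs form, OVER A FIXED LIFT RING `(O, π)`, downstairs centre a closed set `Σ`**: an integral
`H` with a closed immersion `ι : H → ℙⁿ_k`, `O` a complete DVR with algebraically closed residue field, `π : O → k` surjective, a
closed set `Σ ⊆ ι(H)` with `ι(H) ⊄ Σ`, an `O`-SMOOTH centre `C` of `ℙⁿ_O` with `C · 𝒪_{ℙⁿ_k} = vanishingIdeal Σ` along every graded
`φ` over `π`, and SOME blow-up `Z → H` along `(vanishingIdeal Σ) · 𝒪_H` that is point-resolvable for `(Z, univ)`: for every such
`φ` and `Y = (ι ≫ Proj φ)(H)` some `(P′, σ, S′)` in the HorizChainE1 closure of `(ℙⁿ_O, 𝟙, Y)` has regular `V(closure S′)_red`.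
[folklore] -/
theorem horizOver_of_noseThenPoints_intrinsic_closed (k : Type) [Field k] (n : ℕ) (H : Scheme.{0})
    (ι : H ⟶ (Literature.AlgebraicGeometry.Motives.projectiveSpace n k).left) [IsClosedImmersion ι] [IsIntegral H]
    (O : Type) [CommRing O] [IsDomain O] [IsDiscreteValuationRing O]
    [IsAdicComplete (IsLocalRing.maximalIdeal O) O] [IsAlgClosed (IsLocalRing.ResidueField O)]
    (π : O →+* k) (hπ : Function.Surjective π)
    (Sig : Set (Literature.AlgebraicGeometry.Motives.projectiveSpace n k).left) (hSig : IsClosed Sig)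
    (hsupp : Sig ⊆ Set.range ι) (hgen : ¬ (Set.range ι ⊆ Sig))
    (C : (Proj (homogeneousSubmodule (Fin (n + 1)) O)).IdealSheafData)
    (hCsm : Smooth (C.subschemeι ≫ Proj.toSpecZero (homogeneousSubmodule (Fin (n + 1)) O) ≫
      Spec.map (CommRingCat.ofHom (algebraMap O (homogeneousSubmodule (Fin (n + 1)) O 0)))))
    (hKEY : ∀ (φ : homogeneousSubmodule (Fin (n + 1)) O →+*ᵍ homogeneousSubmodule (Fin (n + 1)) k)
      (hφ' : HomogeneousIdeal.irrelevant (homogeneousSubmodule (Fin (n + 1)) k) ≤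
        (HomogeneousIdeal.irrelevant (homogeneousSubmodule (Fin (n + 1)) O)).map φ),
      (∀ s, φ s = MvPolynomial.map π s) →
        C.comap (Proj.map φ hφ') = vanishingIdeal (⟨Sig, hSig⟩ : Closeds (Literature.AlgebraicGeometry.Motives.projectiveSpace n k).left))
    (hdown : ∃ (Z : Scheme.{0}) (ρ : Z ⟶ H),
      IsBlowup ρ ((vanishingIdeal (⟨Sig, hSig⟩ : Closeds (Literature.AlgebraicGeometry.Motives.projectiveSpace n k).left)).comap ι) ∧
      ∃ (F' : Scheme.{0}) (ρ' : F' ⟶ Z) (T' : Set F'),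
        (∀ Q : (∀ F₁ : Scheme.{0}, (F₁ ⟶ Z) → Set F₁ → Prop), Q Z (𝟙 Z) Set.univ →
          (∀ (F₁ F₃ : Scheme.{0}) (ρ₁ : F₁ ⟶ Z) (T₁ : Set F₁)
            (x : ↥(vanishingIdeal (⟨closure T₁, isClosed_closure⟩ : Closeds F₁)).subscheme) (υ₁ : F₃ ⟶ F₁)
            (hx : IsClosed ({((vanishingIdeal (⟨closure T₁, isClosed_closure⟩ : Closeds F₁)).subschemeι x : F₁)} : Set F₁)),
            Q F₁ ρ₁ T₁ →
            ¬ IsRegularLocalRing ((vanishingIdeal (⟨closure T₁, isClosed_closure⟩ : Closeds F₁)).subscheme.presheaf.stalk x) →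
            IsBlowup υ₁ (vanishingIdeal
              (⟨{((vanishingIdeal (⟨closure T₁, isClosed_closure⟩ : Closeds F₁)).subschemeι x : F₁)}, hx⟩ : Closeds F₁)) →
            Q F₃ (υ₁ ≫ ρ₁) (closure (υ₁ ⁻¹' (T₁ \
              {((vanishingIdeal (⟨closure T₁, isClosed_closure⟩ : Closeds F₁)).subschemeι x : F₁)})))) →
          Q F' ρ' T') ∧
        Scheme.IsRegular (vanishingIdeal (⟨closure T', isClosed_closure⟩ : Closeds F')).subscheme) :
    ∀ (φ : homogeneousSubmodule (Fin (n + 1)) O →+*ᵍ homogeneousSubmodule (Fin (n + 1)) k)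
      (hφ' : HomogeneousIdeal.irrelevant (homogeneousSubmodule (Fin (n + 1)) k) ≤
        (HomogeneousIdeal.irrelevant (homogeneousSubmodule (Fin (n + 1)) O)).map φ),
      (∀ s, φ s = MvPolynomial.map π s) →
    ∀ Y : Set (Proj (homogeneousSubmodule (Fin (n + 1)) O)), Y = Set.range (ι ≫ Proj.map φ hφ') →
    ∃ (P' : Scheme.{0}) (σ : P' ⟶ Proj (homogeneousSubmodule (Fin (n + 1)) O)) (S' : Set P'),
      (∀ Q : (∀ X' : Scheme.{0}, (X' ⟶ Proj (homogeneousSubmodule (Fin (n + 1)) O)) → Set X' → Prop),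
        Q (Proj (homogeneousSubmodule (Fin (n + 1)) O)) (𝟙 _) Y →
        (∀ (X' X'' : Scheme.{0}) (σ' : X' ⟶ Proj (homogeneousSubmodule (Fin (n + 1)) O)) (Y' : Set X')
          (C : X'.IdealSheafData) (τ : X'' ⟶ X'), Q X' σ' Y' → IsBlowup τ C → Scheme.IsRegular C.subscheme →
          Flat (C.subschemeι ≫ σ' ≫ (Proj.toSpecZero (homogeneousSubmodule (Fin (n + 1)) O) ≫
            Spec.map (CommRingCat.ofHom (algebraMap O (homogeneousSubmodule (Fin (n + 1)) O 0))))) →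
          σ' '' (C.support : Set X') ⊆ {x | ¬ IsGenericPoint x Y} →
          (C.support : Set X') ∩ (σ' ≫ (Proj.toSpecZero (homogeneousSubmodule (Fin (n + 1)) O) ≫
            Spec.map (CommRingCat.ofHom (algebraMap O (homogeneousSubmodule (Fin (n + 1)) O 0))))) ⁻¹'
            {IsLocalRing.closedPoint O} ⊆ Y' →
          Q X'' (τ ≫ σ') (closure (τ ⁻¹' (Y' \ (C.support : Set X'))))) → Q P' σ S') ∧
      Scheme.IsRegular (vanishingIdeal (⟨closure S', isClosed_closure⟩ : Closeds P')).subscheme := by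
  intro φ hφ' hφ Y hY
  let ι' : H ⟶ Proj (homogeneousSubmodule (Fin (n + 1)) k) := ι
  haveI : IsClosedImmersion ι' := ‹IsClosedImmersion ι›
  have hK := hKEY φ hφ' hφ
  have hS : ((C.comap (Proj.map φ hφ')).support : Set (Proj (homogeneousSubmodule (Fin (n + 1)) k))) = Sig := by
    rw [hK]
    exact Scheme.IdealSheafData.coe_support_vanishingIdeal
      (X := (Literature.AlgebraicGeometry.Motives.projectiveSpace n k).left) ⟨Sig, hSig⟩
  have hdown' := hdown
  rw [← hK] at hdown'
  obtain ⟨P', σ, S', hH, -, -, hreg⟩ := horiz_of_noseThenPoints_intrinsic O k π hπ n H ι' φ hφ' hφ C hCsm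
    (by rw [hS]; exact hgen) (by rw [hS]; exact hsupp) hdown' Y hY
  exact ⟨P', σ, S', hH, hreg⟩

/-- **Horizontal (5), intrinsic downstairs form, FROM A LIFT SUPPLY — TARGET-CINOSE's conclusion verbatim.** For a prime `p`, an
algebraically closed field `k` of characteristic `p`, an integral `H` with a closed immersion `ι : H → ℙⁿ_k`, a closed set `Σ ⊆ ι(H)`
with `ι(H) ⊄ Σ`: IF every complete characteristic-`0` DVR `O` with algebraically closed residue field and surjection `π : O → k`
carries an `O`-SMOOTH centre `C` of `ℙⁿ_O` with `C · 𝒪_{ℙⁿ_k} = vanishingIdeal Σ` along every graded `φ` over `π` (LIFT SUPPLY),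
AND some blow-up `Z → H` along `(vanishingIdeal Σ) · 𝒪_H` is point-resolvable for `(Z, univ)`, THEN there are such `(O, π)`
(`O = 𝕎(k)`, `stub_wittRing`) with, for every `φ` over `π` and `Y = (ι ≫ Proj φ)(H)`, some `(P′, σ, S′)` in the HorizChainE1
closure of `(ℙⁿ_O, 𝟙, Y)` with regular `V(closure S′)_red`. [folklore; Serre 1979 II §5–6 for `𝕎(k)`] -/
theorem horizAt_of_noseThenPoints_intrinsic_closed {p : ℕ} (hp : p.Prime) (k : Type) [Field k] [CharP k p] [IsAlgClosed k]
    (n : ℕ) (H : Scheme.{0}) (ι : H ⟶ (Literature.AlgebraicGeometry.Motives.projectiveSpace n k).left) [IsClosedImmersion ι]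
    [IsIntegral H]
    (Sig : Set (Literature.AlgebraicGeometry.Motives.projectiveSpace n k).left) (hSig : IsClosed Sig)
    (hsupp : Sig ⊆ Set.range ι) (hgen : ¬ (Set.range ι ⊆ Sig))
    (hlift : ∀ (O : Type) [CommRing O] [IsDomain O] [IsDiscreteValuationRing O] [CharZero O]
      [IsAdicComplete (IsLocalRing.maximalIdeal O) O] [IsAlgClosed (IsLocalRing.ResidueField O)] (π : O →+* k),
      Function.Surjective π →
      ∃ C : (Proj (homogeneousSubmodule (Fin (n + 1)) O)).IdealSheafData,
        Smooth (C.subschemeι ≫ Proj.toSpecZero (homogeneousSubmodule (Fin (n + 1)) O) ≫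
          Spec.map (CommRingCat.ofHom (algebraMap O (homogeneousSubmodule (Fin (n + 1)) O 0)))) ∧
        ∀ (φ : homogeneousSubmodule (Fin (n + 1)) O →+*ᵍ homogeneousSubmodule (Fin (n + 1)) k)
          (hφ' : HomogeneousIdeal.irrelevant (homogeneousSubmodule (Fin (n + 1)) k) ≤
            (HomogeneousIdeal.irrelevant (homogeneousSubmodule (Fin (n + 1)) O)).map φ),
          (∀ s, φ s = MvPolynomial.map π s) →
            C.comap (Proj.map φ hφ') =
              vanishingIdeal (⟨Sig, hSig⟩ : Closeds (Literature.AlgebraicGeometry.Motives.projectiveSpace n k).left))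
    (hdown : ∃ (Z : Scheme.{0}) (ρ : Z ⟶ H),
      IsBlowup ρ ((vanishingIdeal (⟨Sig, hSig⟩ : Closeds (Literature.AlgebraicGeometry.Motives.projectiveSpace n k).left)).comap ι) ∧
      ∃ (F' : Scheme.{0}) (ρ' : F' ⟶ Z) (T' : Set F'),
        (∀ Q : (∀ F₁ : Scheme.{0}, (F₁ ⟶ Z) → Set F₁ → Prop), Q Z (𝟙 Z) Set.univ →
          (∀ (F₁ F₃ : Scheme.{0}) (ρ₁ : F₁ ⟶ Z) (T₁ : Set F₁)
            (x : ↥(vanishingIdeal (⟨closure T₁, isClosed_closure⟩ : Closeds F₁)).subscheme) (υ₁ : F₃ ⟶ F₁)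
            (hx : IsClosed ({((vanishingIdeal (⟨closure T₁, isClosed_closure⟩ : Closeds F₁)).subschemeι x : F₁)} : Set F₁)),
            Q F₁ ρ₁ T₁ →
            ¬ IsRegularLocalRing ((vanishingIdeal (⟨closure T₁, isClosed_closure⟩ : Closeds F₁)).subscheme.presheaf.stalk x) →
            IsBlowup υ₁ (vanishingIdeal
              (⟨{((vanishingIdeal (⟨closure T₁, isClosed_closure⟩ : Closeds F₁)).subschemeι x : F₁)}, hx⟩ : Closeds F₁)) →
            Q F₃ (υ₁ ≫ ρ₁) (closure (υ₁ ⁻¹' (T₁ \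
              {((vanishingIdeal (⟨closure T₁, isClosed_closure⟩ : Closeds F₁)).subschemeι x : F₁)})))) →
          Q F' ρ' T') ∧
        Scheme.IsRegular (vanishingIdeal (⟨closure T', isClosed_closure⟩ : Closeds F')).subscheme) :
    ∃ (O : Type) (_ : CommRing O) (_ : IsDomain O) (_ : IsDiscreteValuationRing O) (_ : CharZero O) (π : O →+* k),
      Function.Surjective π ∧
      ∀ (φ : homogeneousSubmodule (Fin (n + 1)) O →+*ᵍ homogeneousSubmodule (Fin (n + 1)) k)
        (hφ' : HomogeneousIdeal.irrelevant (homogeneousSubmodule (Fin (n + 1)) k) ≤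
          (HomogeneousIdeal.irrelevant (homogeneousSubmodule (Fin (n + 1)) O)).map φ),
        (∀ s, φ s = MvPolynomial.map π s) →
      ∀ Y : Set (Proj (homogeneousSubmodule (Fin (n + 1)) O)), Y = Set.range (ι ≫ Proj.map φ hφ') →
      ∃ (P' : Scheme.{0}) (σ : P' ⟶ Proj (homogeneousSubmodule (Fin (n + 1)) O)) (S' : Set P'),
        (∀ Q : (∀ X' : Scheme.{0}, (X' ⟶ Proj (homogeneousSubmodule (Fin (n + 1)) O)) → Set X' → Prop),
          Q (Proj (homogeneousSubmodule (Fin (n + 1)) O)) (𝟙 _) Y →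
          (∀ (X' X'' : Scheme.{0}) (σ' : X' ⟶ Proj (homogeneousSubmodule (Fin (n + 1)) O)) (Y' : Set X')
            (C : X'.IdealSheafData) (τ : X'' ⟶ X'), Q X' σ' Y' → IsBlowup τ C → Scheme.IsRegular C.subscheme →
            Flat (C.subschemeι ≫ σ' ≫ (Proj.toSpecZero (homogeneousSubmodule (Fin (n + 1)) O) ≫
              Spec.map (CommRingCat.ofHom (algebraMap O (homogeneousSubmodule (Fin (n + 1)) O 0))))) →
            σ' '' (C.support : Set X') ⊆ {x | ¬ IsGenericPoint x Y} →
            (C.support : Set X') ∩ (σ' ≫ (Proj.toSpecZero (homogeneousSubmodule (Fin (n + 1)) O) ≫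
              Spec.map (CommRingCat.ofHom (algebraMap O (homogeneousSubmodule (Fin (n + 1)) O 0))))) ⁻¹'
              {IsLocalRing.closedPoint O} ⊆ Y' →
            Q X'' (τ ≫ σ') (closure (τ ⁻¹' (Y' \ (C.support : Set X'))))) → Q P' σ S') ∧
        Scheme.IsRegular (vanishingIdeal (⟨closure S', isClosed_closure⟩ : Closeds P')).subscheme := by
  obtain ⟨O, i1, i2, i3, i4, i5, i6, π, hπ⟩ := stub_wittRing p hp k
  obtain ⟨C, hCsm, hKEY⟩ := hlift O π hπ
  exact ⟨O, i1, i2, i3, i4, π, hπ,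
    horizOver_of_noseThenPoints_intrinsic_closed k n H ι O π hπ Sig hSig hsupp hgen C hCsm hKEY hdown⟩

/-- **(L2)'s SHAPE — an `O`-smooth nose whose downstairs blow-up is already regular.** For a prime `p`, `k` algebraically closed of
characteristic `p`, an integral `H` with a closed immersion `ι : H → ℙⁿ_k`, a closed set `Σ ⊆ ι(H)` with `ι(H) ⊄ Σ`, a LIFT SUPPLY
for `Σ` (as in `horizAt_of_noseThenPoints_intrinsic_closed`), and SOME blow-up `Z → H` along `(vanishingIdeal Σ) · 𝒪_H` that is
REGULAR: TARGET-CINOSE's conclusion holds for `(k, n, H, ι)` (zero point steps, `pointResolvable_univ_of_isRegular` of the sibling file). This is the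
horizontal-currency form of res-D-pv-027's rung (L2) «T-ORD-CI» for an arbitrary closed `Σ` with a lift supply. [folklore] -/
theorem horizAt_of_nose_of_isRegular_blowup_closed {p : ℕ} (hp : p.Prime) (k : Type) [Field k] [CharP k p] [IsAlgClosed k]
    (n : ℕ) (H : Scheme.{0}) (ι : H ⟶ (Literature.AlgebraicGeometry.Motives.projectiveSpace n k).left) [IsClosedImmersion ι]
    [IsIntegral H]
    (Sig : Set (Literature.AlgebraicGeometry.Motives.projectiveSpace n k).left) (hSig : IsClosed Sig)
    (hsupp : Sig ⊆ Set.range ι) (hgen : ¬ (Set.range ι ⊆ Sig))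
    (hlift : ∀ (O : Type) [CommRing O] [IsDomain O] [IsDiscreteValuationRing O] [CharZero O]
      [IsAdicComplete (IsLocalRing.maximalIdeal O) O] [IsAlgClosed (IsLocalRing.ResidueField O)] (π : O →+* k),
      Function.Surjective π →
      ∃ C : (Proj (homogeneousSubmodule (Fin (n + 1)) O)).IdealSheafData,
        Smooth (C.subschemeι ≫ Proj.toSpecZero (homogeneousSubmodule (Fin (n + 1)) O) ≫
          Spec.map (CommRingCat.ofHom (algebraMap O (homogeneousSubmodule (Fin (n + 1)) O 0)))) ∧
        ∀ (φ : homogeneousSubmodule (Fin (n + 1)) O →+*ᵍ homogeneousSubmodule (Fin (n + 1)) k)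
          (hφ' : HomogeneousIdeal.irrelevant (homogeneousSubmodule (Fin (n + 1)) k) ≤
            (HomogeneousIdeal.irrelevant (homogeneousSubmodule (Fin (n + 1)) O)).map φ),
          (∀ s, φ s = MvPolynomial.map π s) →
            C.comap (Proj.map φ hφ') =
              vanishingIdeal (⟨Sig, hSig⟩ : Closeds (Literature.AlgebraicGeometry.Motives.projectiveSpace n k).left))
    (hZ : ∃ (Z : Scheme.{0}) (ρ : Z ⟶ H),
      IsBlowup ρ ((vanishingIdeal (⟨Sig, hSig⟩ : Closeds (Literature.AlgebraicGeometry.Motives.projectiveSpace n k).left)).comap ι) ∧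
      Scheme.IsRegular Z) :
    ∃ (O : Type) (_ : CommRing O) (_ : IsDomain O) (_ : IsDiscreteValuationRing O) (_ : CharZero O) (π : O →+* k),
      Function.Surjective π ∧
      ∀ (φ : homogeneousSubmodule (Fin (n + 1)) O →+*ᵍ homogeneousSubmodule (Fin (n + 1)) k)
        (hφ' : HomogeneousIdeal.irrelevant (homogeneousSubmodule (Fin (n + 1)) k) ≤
          (HomogeneousIdeal.irrelevant (homogeneousSubmodule (Fin (n + 1)) O)).map φ),
        (∀ s, φ s = MvPolynomial.map π s) →
      ∀ Y : Set (Proj (homogeneousSubmodule (Fin (n + 1)) O)), Y = Set.range (ι ≫ Proj.map φ hφ') →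
      ∃ (P' : Scheme.{0}) (σ : P' ⟶ Proj (homogeneousSubmodule (Fin (n + 1)) O)) (S' : Set P'),
        (∀ Q : (∀ X' : Scheme.{0}, (X' ⟶ Proj (homogeneousSubmodule (Fin (n + 1)) O)) → Set X' → Prop),
          Q (Proj (homogeneousSubmodule (Fin (n + 1)) O)) (𝟙 _) Y →
          (∀ (X' X'' : Scheme.{0}) (σ' : X' ⟶ Proj (homogeneousSubmodule (Fin (n + 1)) O)) (Y' : Set X')
            (C : X'.IdealSheafData) (τ : X'' ⟶ X'), Q X' σ' Y' → IsBlowup τ C → Scheme.IsRegular C.subscheme →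
            Flat (C.subschemeι ≫ σ' ≫ (Proj.toSpecZero (homogeneousSubmodule (Fin (n + 1)) O) ≫
              Spec.map (CommRingCat.ofHom (algebraMap O (homogeneousSubmodule (Fin (n + 1)) O 0))))) →
            σ' '' (C.support : Set X') ⊆ {x | ¬ IsGenericPoint x Y} →
            (C.support : Set X') ∩ (σ' ≫ (Proj.toSpecZero (homogeneousSubmodule (Fin (n + 1)) O) ≫
              Spec.map (CommRingCat.ofHom (algebraMap O (homogeneousSubmodule (Fin (n + 1)) O 0))))) ⁻¹'
              {IsLocalRing.closedPoint O} ⊆ Y' →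
            Q X'' (τ ≫ σ') (closure (τ ⁻¹' (Y' \ (C.support : Set X'))))) → Q P' σ S') ∧
        Scheme.IsRegular (vanishingIdeal (⟨closure S', isClosed_closure⟩ : Closeds P')).subscheme := by
  obtain ⟨Z, ρ, hρ, hZreg⟩ := hZ
  exact horizAt_of_noseThenPoints_intrinsic_closed hp k n H ι Sig hSig hsupp hgen hlift
    ⟨Z, ρ, hρ, pointResolvable_univ_of_isRegular Z hZreg⟩

end Summit.ResolutionOfSingularities.ResolutionOfSingularities.Cruxes.EquisingularLiftNat.Sections

end
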